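import Mathlib
import Literature.Probability.Percolation.PercolationProofs
import Literature.Probability.LatticeModels.ProdBernoulliIndependence
import Literature.Probability.LatticeModels.ProdBernoulliClusterLocality
import Literature.Probability.LatticeModels.ProdBernoulliCoupling
import Literature.Probability.Percolation.KozmaNitzanPinning
import Summits.CriticalPhenomena.PercolationContinuityZ3.Theorems.PercNearOneGluingAdditiveGluingGluingLemma5
import HarnessLib

/-! # Crux `PercNearOneGluing.AdditiveGluing` (stmt-CriticalPhenomena-4576), line `subuniform-dead-pocket-maximum` — stub `stub_lemma5AnyRelay`

Helper file for the crux skeleton of the line `subuniform-dead-pocket-maximum`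
(lead prover-line-stmt-CriticalPhenomena-4576-c1-0).  Proves exactly the registered stub signature
`stub_lemma5AnyRelay`; lands with `--supports stmt-CriticalPhenomena-4576`.

## Content

Kozma–Nitzan, arXiv:2401.12397, **Lemma 5** (p. 13) for an ARBITRARY relay `a`, in `σ_B` form, on
the weighted complete graph `Fin n` (`μ_w = prodBernoulli w` on `Set (Sym2 (Fin n))`).  For a vertex
`o`, a finite `B ∌ o` and the event
`σ_B = {ω | for every y ≠ o, the pair o–y is open iff y ∈ B}` ("the open star of `o` is exactly
`o–B`"): if `b ≠ o`, `a ≠ o`, `v ∈ B` and `a` is at most as reliable as `v` OFF `o`,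
`μ_w(a ↔ b in {o}ᶜ) ≤ μ_w(v ↔ b in {o}ᶜ)`, then `μ_w(σ_B ∩ {a ↔ b}) ≤ μ_w(σ_B ∩ {o ↔ b})`.

## Proof

The `ε`-argument of the printed proof (sprinkling + KN Lemma 3(i) + `ε → 0`) is the accepted block
form `stub_gluingLemma5` (file `…GluingLemma5.lean`); here it is transported to the `σ_B` form by
three exact identities for inhomogeneous product measures, all from `KozmaNitzanPinning.lean`.
* If `b ∈ B` then `σ_B ⊆ {o–b open} ⊆ {o ↔ b}` and the claim is monotonicity of `μ_w`.  Let `b ∉ B`.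
* Conditioning on `σ_B` is pinning (`prodBernoulli_real_inter_localCylinder`): `σ_B` is the cylinder
  `[ξ]_F`, `F` the star of `o` (non-loop pairs containing `o`), `ξ = {o–y | y ∈ B}`, and
  `μ_w(σ_B ∩ X) = μ_w(σ_B) · μ_pin(X)` with `pin = pinW w F ξ` (weight `1` on `o–B`, `0` on the rest
  of the star, `w` elsewhere).  It remains to show `μ_pin(a ↔ b) ≤ μ_pin(o ↔ b)`.
* Killing the star is deleting `o`: for `w⁰ = w` off the star and `0` on it and `x ≠ o`,
  `μ_w(x ↔ b in {o}ᶜ) = μ_{w⁰}(x ↔ b)` (the event is determined by the pairs inside `{o}ᶜ`, where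
  the weights agree, and `μ_{w⁰}`-a.s. no pair of the star is open, so an open path from `x ≠ o`
  never visits `o`).  Hence `μ_{w⁰}(a ↔ b) ≤ μ_{w⁰}(v ↔ b)`, and `stub_gluingLemma5` with the block
  `S = insert o B ∌ b` gives `μ_g(a ↔ b) ≤ μ_g(S ↔ b)` for the glued weighting `g` (`1` on the
  non-loop pairs inside `S`, `w⁰` elsewhere).
* `g` is the WIRING of `pin` along `S` (`g = wireW S pin`: both are `1` inside `S`, `0` on the star
  pairs leaving `S`, `w` elsewhere), so `μ_pin(a ↔ b) ≤ μ_g(a ↔ b)` by the monotone coupling, and by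
  the wiring identity `prodBernoulli_wireW_real_openConn` (twice: wiring is idempotent)
  `μ_g(S ↔ b) = μ_g(b ↔ o) = μ_pin(b ↔ S)`; finally `μ_pin`-a.s. every pair `o–y`, `y ∈ B`, is open,
  so `{b ↔ S} = {o ↔ b}` `μ_pin`-a.s.
-/

namespace Summit.CriticalPhenomena.PercolationContinuityZ3.Theorems

open MeasureTheory Set
open Literature.Probability.LatticeModels (prodBernoulli)
open Literature.Probability.Percolation (BondConfig openConn openConnIn openGraph openCluster)

noncomputable section
open Classical

section Lemma5AnyRelayAux

open Filter
open Literature.Probability.LatticeModels Literature.Probability.Percolation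

variable {n : ℕ}

/-- A walk of `G` from `x ≠ o`, along which no edge ends at `o`, is a path inside `{o}ᶜ`.
[folklore] -/
theorem lemma5AnyRelay_pathIn_compl {V : Type*} {G : SimpleGraph V} {o x b : V} (hx : x ≠ o)
    (hstep : ∀ p q, G.Adj p q → q ≠ o) (h : G.Reachable x b) :
    PathIn G ({o}ᶜ : Set V) x b := by
  rw [SimpleGraph.reachable_iff_reflTransGen] at h
  refine ⟨Set.mem_compl_singleton_iff.2 hx, ?_⟩
  induction h with
  | refl => exact Relation.ReflTransGen.refl
  | tail _ hbc ih => exact ih.tail ⟨hbc, Set.mem_compl_singleton_iff.2 (hstep _ _ hbc)⟩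

/-- **Killing the star of `o` is deleting `o`**, for connection probabilities: if `w'` agrees with
`w` on the pairs inside `{o}ᶜ` and vanishes on every pair `o–y`, `y ≠ o`, then for `x ≠ o`
`μ_w(x ↔ b in {o}ᶜ) = μ_{w'}(x ↔ b)` (the event `{x ↔ b in {o}ᶜ}` is determined by the pairs
inside `{o}ᶜ`; `μ_{w'}`-a.s. the star of `o` is closed, and then an open path from `x` never
visits `o`).  (Kozma–Nitzan 2024, p. 13: "`G'`, i.e. we disconnect 0 from all vertices…".) [folklore] -/
theorem lemma5AnyRelay_real_openConnIn_compl_eq (w w' : Sym2 (Fin n) → unitInterval)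
    (o x b : Fin n) (hx : x ≠ o) (h1 : ∀ e ∈ (({o} : Set (Fin n))ᶜ).sym2, w e = w' e)
    (h2 : ∀ y : Fin n, y ≠ o → w' s(o, y) = 0) :
    (prodBernoulli w).real (openConnIn (({o} : Set (Fin n))ᶜ) x b) =
      (prodBernoulli w').real (openConn x b) := by
  rw [prodBernoulli_real_eq_of_determinedBy w w' h1
    (DCT16.determinedBy_openConnIn _ x b subset_rfl) MeasurableSet.of_discrete]
  refine measureReal_congr ?_
  have hae : ∀ᵐ ω ∂prodBernoulli w', ∀ y : Fin n, y ≠ o → s(o, y) ∉ ω := by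
    refine ae_all_iff.2 fun y => ?_
    by_cases hy : y = o
    · exact Eventually.of_forall fun ω h => absurd hy h
    · filter_upwards [prodBernoulli_ae_notMem w' (h2 y hy)] with ω hω using fun _ => hω
  filter_upwards [hae] with ω hω
  refine propext ⟨fun h => openConnIn_subset_openConn _ x b h, fun h => ?_⟩
  refine DCT16.mem_openConnIn_of_pathIn
    (lemma5AnyRelay_pathIn_compl hx (fun p q hpq hq => ?_) h)
  rw [openGraph_adj, hq, Sym2.eq_swap] at hpq
  exact hω p hpq.2 hpq.1

/-- Under a weighting giving weight `1` to every pair `o–y`, `y ∈ B`, the events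
`{b ↔ insert o B}` and `{o ↔ b}` almost surely coincide (a vertex of `B` reached from `b` is a.s.
joined to `o` by its open pair). [folklore] -/
theorem lemma5AnyRelay_real_biUnion_eq (p : Sym2 (Fin n) → unitInterval) (o b : Fin n)
    (B : Finset (Fin n)) (hoB : o ∉ B) (hp : ∀ y ∈ B, p s(o, y) = 1) :
    (prodBernoulli p).real (⋃ t ∈ (↑(insert o B) : Set (Fin n)), openConn b t) =
      (prodBernoulli p).real (openConn o b) := by
  have hae : ∀ᵐ ω ∂prodBernoulli p, ∀ y : Fin n, y ∈ B → s(o, y) ∈ ω := by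
    refine ae_all_iff.2 fun y => ?_
    by_cases hy : y ∈ B
    · filter_upwards [prodBernoulli_ae_mem_of_eq_one p (hp y hy)] with ω hω using fun _ => hω
    · exact Eventually.of_forall fun ω h => absurd h hy
  refine measureReal_congr ?_
  filter_upwards [hae] with ω hω
  refine propext ⟨fun h => ?_, fun h => ?_⟩
  · obtain ⟨t, ht, hbt⟩ := Set.mem_iUnion₂.1 h
    rcases Finset.mem_insert.1 (Finset.mem_coe.1 ht) with rfl | htB
    · exact SimpleGraph.Reachable.symm hbt
    · have hto : t ≠ o := fun h => hoB (h ▸ htB)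
      have hadj : (openGraph ω).Adj t o :=
        (openGraph_adj ω t o).2 ⟨by rw [Sym2.eq_swap]; exact hω t htB, hto⟩
      exact (SimpleGraph.Reachable.trans hbt hadj.reachable).symm
  · exact Set.mem_iUnion₂.2
      ⟨o, Finset.mem_coe.2 (Finset.mem_insert_self o B), SimpleGraph.Reachable.symm h⟩

/-- Wiring twice is wiring once. [folklore] -/
theorem lemma5AnyRelay_wireW_wireW {V : Type*} (T : Set V) (p : Sym2 V → unitInterval) :
    wireW T (wireW T p) = wireW T p := by
  funext e
  by_cases he : e ∈ wireSet T
  · rw [wireW_apply_of_mem _ he, wireW_apply_of_mem _ he]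
  · rw [wireW_apply_of_not_mem _ he, wireW_apply_of_not_mem _ he]

/-- **Wiring the block does not change `P(S ↔ b)`, and under an open star it is `P(o ↔ b)`**:
for a weighting `p` with `p(o–y) = 1` for all `y ∈ B` and `S = insert o B`,
`μ_{wireW S p}(S ↔ b) = μ_p(o ↔ b)` (the wiring identity `prodBernoulli_wireW_real_openConn`
twice, then `lemma5AnyRelay_real_biUnion_eq`).
[cite: KozmaNitzan2024, §3.2 p. 13 (proof of Lemma 5: "when ω ∈ σ then a ↔ b ⟺ 0 ↔ b")] -/
theorem lemma5AnyRelay_wire_real_biUnion (p : Sym2 (Fin n) → unitInterval) (o b : Fin n)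
    (B : Finset (Fin n)) (hoB : o ∉ B) (hp : ∀ y ∈ B, p s(o, y) = 1) :
    (prodBernoulli (wireW (↑(insert o B) : Set (Fin n)) p)).real
        (⋃ s ∈ insert o B, openConn s b) =
      (prodBernoulli p).real (openConn o b) := by
  have hoS : o ∈ (↑(insert o B) : Set (Fin n)) := Finset.mem_coe.2 (Finset.mem_insert_self o B)
  have h1 : (⋃ s ∈ insert o B, openConn s b : Set (BondConfig (Fin n))) =
      ⋃ t ∈ (↑(insert o B) : Set (Fin n)), openConn b t := by
    ext ω
    constructor
    · intro h
      obtain ⟨t, ht, hbt⟩ := Set.mem_iUnion₂.1 h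
      exact Set.mem_iUnion₂.2 ⟨t, Finset.mem_coe.2 ht, SimpleGraph.Reachable.symm hbt⟩
    · intro h
      obtain ⟨t, ht, hbt⟩ := Set.mem_iUnion₂.1 h
      exact Set.mem_iUnion₂.2 ⟨t, Finset.mem_coe.1 ht, SimpleGraph.Reachable.symm hbt⟩
  rw [h1, ← lemma5AnyRelay_real_biUnion_eq p o b B hoB hp,
    ← prodBernoulli_wireW_real_openConn p _ hoS b,
    ← prodBernoulli_wireW_real_openConn (wireW _ p) _ hoS b, lemma5AnyRelay_wireW_wireW]

end Lemma5AnyRelayAux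

open Filter Literature.Probability.LatticeModels Literature.Probability.Percolation in
/-- Registered stub `stub_lemma5AnyRelay` of crux stmt-CriticalPhenomena-4576 (line
subuniform-dead-pocket-maximum): **KN Lemma 5 for an arbitrary relay, `σ_B` form** — for
`b ≠ o`, `a ≠ o`, `o ∉ B ∋ v` and `μ_w(a ↔ b in {o}ᶜ) ≤ μ_w(v ↔ b in {o}ᶜ)`,
`μ_w(σ_B ∩ {a ↔ b}) ≤ μ_w(σ_B ∩ {o ↔ b})` with
`σ_B = {ω | ∀ y ≠ o, o–y open ↔ y ∈ B}`.  See the module docstring for the proof.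
[cite: KozmaNitzan2024, §3.2 Lemma 5 (p. 13)] -/
theorem stub_lemma5AnyRelay :
    ∀ (n : ℕ) (w : Sym2 (Fin n) → unitInterval) (o b a v : Fin n) (B : Finset (Fin n)),
      b ≠ o → a ≠ o → o ∉ B → v ∈ B →
      (prodBernoulli w).real (openConnIn (({o} : Set (Fin n))ᶜ) a b)
        ≤ (prodBernoulli w).real (openConnIn (({o} : Set (Fin n))ᶜ) v b) →
      (prodBernoulli w).real
          ({ω : BondConfig (Fin n) | ∀ y : Fin n, y ≠ o → (s(o, y) ∈ ω ↔ y ∈ B)} ∩ openConn a b)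
        ≤ (prodBernoulli w).real
          ({ω : BondConfig (Fin n) | ∀ y : Fin n, y ≠ o → (s(o, y) ∈ ω ↔ y ∈ B)} ∩ openConn o b)
    := by
  intro n w o b a v B hbo hao hoB hvB hle
  -- Case `b ∈ B`: under `σ_B` the pair `o–b` is open, so `σ_B ⊆ {o ↔ b}`.
  by_cases hbB : b ∈ B
  · have hsub : {ω : BondConfig (Fin n) | ∀ y : Fin n, y ≠ o → (s(o, y) ∈ ω ↔ y ∈ B)} ⊆
        openConn o b := fun ω hω =>
      ((openGraph_adj ω o b).2 ⟨(hω b hbo).2 hbB, hbo.symm⟩).reachable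
    rw [Set.inter_eq_left.2 hsub]
    exact measureReal_mono Set.inter_subset_left (measure_ne_top _ _)
  -- Henceforth `b ∉ B`.
  have hvo : v ≠ o := fun h => hoB (h ▸ hvB)
  -- the star `F` of `o` and the pattern `ξ = {o–y | y ∈ B}` on it
  obtain ⟨F, hmemF⟩ : ∃ F : Finset (Sym2 (Fin n)),
      ∀ e, e ∈ (↑F : Set (Sym2 (Fin n))) ↔ o ∈ e ∧ ¬ e.IsDiag :=
    ⟨Finset.univ.filter fun e => o ∈ e ∧ ¬ e.IsDiag, fun e => by simp⟩
  obtain ⟨ξ, hmemξ⟩ : ∃ ξ : Set (Sym2 (Fin n)), ∀ y : Fin n, s(o, y) ∈ ξ ↔ y ∈ B := by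
    refine ⟨(fun y => s(o, y)) '' ↑B, fun y => ?_⟩
    rw [Function.Injective.mem_set_image fun y y' h => Sym2.congr_right.1 h, Finset.mem_coe]
  have hstar : ∀ y : Fin n, y ≠ o → s(o, y) ∈ (↑F : Set (Sym2 (Fin n))) := fun y hy =>
    (hmemF _).2 ⟨Sym2.mem_mk_left o y, fun h => hy (Sym2.mk_isDiag_iff.1 h).symm⟩
  -- `σ_B` is the cylinder `[ξ]_F`
  have hσ : {ω : BondConfig (Fin n) | ∀ y : Fin n, y ≠ o → (s(o, y) ∈ ω ↔ y ∈ B)} =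
      localCylinder (↑F : Set (Sym2 (Fin n))) ξ := by
    ext ω
    constructor
    · intro hω e he
      obtain ⟨hoe, hde⟩ := (hmemF e).1 he
      obtain ⟨y, rfl⟩ := Sym2.mem_iff_exists.1 hoe
      rw [hmemξ]
      exact hω y fun h => hde (Sym2.mk_isDiag_iff.2 h.symm)
    · intro hω y hyo
      rw [← hmemξ y]
      exact hω _ (hstar y hyo)
  -- conditioning on `σ_B` is pinning
  have hcond : ∀ X : Set (BondConfig (Fin n)),
      (prodBernoulli w).real (localCylinder (↑F : Set (Sym2 (Fin n))) ξ ∩ X) =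
        (prodBernoulli w).real (localCylinder (↑F : Set (Sym2 (Fin n))) ξ) *
          (prodBernoulli (pinW w ↑F ξ)).real X := fun X => by
    rw [Set.inter_comm]
    exact prodBernoulli_real_inter_localCylinder w F ξ MeasurableSet.of_discrete
  rw [hσ, hcond, hcond]
  refine mul_le_mul_of_nonneg_left ?_ measureReal_nonneg
  -- kill the star of `o`: the weighting `w0`, and the hypothesis in `w0`-form
  obtain ⟨w0, hw0⟩ : ∃ w0 : Sym2 (Fin n) → unitInterval,
      ∀ e, w0 e = if o ∈ e ∧ ¬ e.IsDiag then 0 else w e := ⟨_, fun _ => rfl⟩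
  have hW1 : ∀ e ∈ (({o} : Set (Fin n))ᶜ).sym2, w e = w0 e := by
    intro e he
    induction e with
    | h x y =>
      rw [Set.mk_mem_sym2_iff, Set.mem_compl_singleton_iff, Set.mem_compl_singleton_iff] at he
      have hne : ¬ (o ∈ s(x, y) ∧ ¬ (s(x, y)).IsDiag) := fun h => by
        rcases Sym2.mem_iff.1 h.1 with h' | h'
        · exact he.1 h'.symm
        · exact he.2 h'.symm
      rw [hw0, if_neg hne]
  have hW2 : ∀ y : Fin n, y ≠ o → w0 s(o, y) = 0 := fun y hy => by
    rw [hw0, if_pos ((hmemF _).1 (hstar y hy))]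
  have hle0 : (prodBernoulli w0).real (openConn a b) ≤ (prodBernoulli w0).real (openConn v b) := by
    rw [← lemma5AnyRelay_real_openConnIn_compl_eq w w0 o a b hao hW1 hW2,
      ← lemma5AnyRelay_real_openConnIn_compl_eq w w0 o v b hvo hW1 hW2]
    exact hle
  -- glue the block `S = insert o B`
  have hvS : v ∈ insert o B := Finset.mem_insert_of_mem hvB
  have hbS : b ∉ insert o B := by simp [hbo, hbB]
  have hglue := stub_gluingLemma5 n w0 (insert o B) a v b hvS hbS hle0
  -- the glued weighting is the wiring of the pinned one
  have hW3 : ∀ e : Sym2 (Fin n),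
      (if (∀ x ∈ e, x ∈ insert o B) ∧ ¬ e.IsDiag then (1 : unitInterval) else w0 e) =
        wireW (↑(insert o B) : Set (Fin n)) (pinW w ↑F ξ) e := by
    intro e
    have hwire : e ∈ wireSet (↑(insert o B) : Set (Fin n)) ↔
        (∀ x ∈ e, x ∈ insert o B) ∧ ¬ e.IsDiag := by
      simp only [wireSet, Set.mem_setOf_eq, Finset.mem_coe]
    by_cases he : (∀ x ∈ e, x ∈ insert o B) ∧ ¬ e.IsDiag
    · rw [if_pos he, wireW_apply_of_mem _ (hwire.2 he)]
    · rw [if_neg he, wireW_apply_of_not_mem _ fun h => he (hwire.1 h), hw0 e]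
      by_cases hoe : o ∈ e ∧ ¬ e.IsDiag
      · rw [if_pos hoe]
        obtain ⟨y, rfl⟩ := Sym2.mem_iff_exists.1 hoe.1
        have hyB : y ∉ B := by
          intro hyB
          refine he ⟨fun x hx => ?_, hoe.2⟩
          rcases Sym2.mem_iff.1 hx with rfl | rfl
          · exact Finset.mem_insert_self _ _
          · exact Finset.mem_insert_of_mem hyB
        exact (pinW_apply_of_mem_of_not_mem w ((hmemF _).2 hoe)
          fun h => hyB ((hmemξ y).1 h)).symm
      · rw [if_neg hoe]
        exact (pinW_apply_of_not_mem w ξ fun h => hoe ((hmemF e).1 h)).symm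
  rw [show (fun e : Sym2 (Fin n) =>
      if (∀ x ∈ e, x ∈ insert o B) ∧ ¬ e.IsDiag then (1 : unitInterval) else w0 e) =
      wireW (↑(insert o B) : Set (Fin n)) (pinW w ↑F ξ) from funext hW3] at hglue
  -- every pair `o–y`, `y ∈ B`, is pinned open
  have hW4 : ∀ y ∈ B, pinW w (↑F : Set (Sym2 (Fin n))) ξ s(o, y) = 1 := fun y hy =>
    pinW_apply_of_mem_of_mem w (hstar y fun h => hoB (h ▸ hy)) ((hmemξ y).2 hy)
  calc (prodBernoulli (pinW w (↑F : Set (Sym2 (Fin n))) ξ)).real (openConn a b)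
      ≤ (prodBernoulli (wireW (↑(insert o B) : Set (Fin n)) (pinW w ↑F ξ))).real
          (openConn a b) :=
        prodBernoulli_real_mono_of_isUpperSet (le_wireW _ _) (isUpperSet_openConn a b)
          MeasurableSet.of_discrete
    _ ≤ (prodBernoulli (wireW (↑(insert o B) : Set (Fin n)) (pinW w ↑F ξ))).real
          (⋃ s ∈ insert o B, openConn s b) := hglue
    _ = (prodBernoulli (pinW w (↑F : Set (Sym2 (Fin n))) ξ)).real (openConn o b) :=
        lemma5AnyRelay_wire_real_biUnion _ o b B hoB hW4

end

end Summit.CriticalPhenomena.PercolationContinuityZ3.Theorems
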